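import Literature.NumberTheory.EllipticCurves.EisensteinValuesAtI
import Literature.NumberTheory.EllipticCurves.EisensteinValuesAtRho
import Literature.Analysis.SpecialFunctions.EquianharmonicConstant
import Mathlib.Analysis.Real.Pi.Bounds
import Mathlib.Analysis.Complex.ExponentialBounds
import HarnessLib

/-!
# Eisenstein series at `τ = ρ`, weight six: `E₆(ρ) = 27Γ(1/3)¹⁸/(2⁹π¹²)`; the lattice `ℤρ + ℤ` has `g₃ = Γ(1/3)¹⁸/(64π⁶)`

Topic `Literature/NumberTheory/EllipticCurves` (the modular-forms / complex-lattice cluster). Companion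
of `EisensteinValuesAtI.lean` (`E₂(i) = 3/π`, `E₄(i) = 3Γ(1/4)⁸/(2π)⁶`, `g₂(ℤi + ℤ) = Γ(1/4)⁸/(16π²)`)
and `EisensteinValuesAtRho.lean` (`E₂(ρ) = 2√3/π`, the nome `e^{2πiρ} = −e^{−π√3}`), for the
second elliptic point `ρ = e^{2πi/3}` (Mathlib's `UpperHalfPlane.ρ`) and the Eisenstein lattice
`Λ_ρ = ℤρ + ℤ = ℤ[ρ]` (namespace `EisensteinLattice`; `g₂(Λ_ρ) = 0` is
`PeriodPair.g₂_ofUpperHalfPlane_ρ` of `LatticeJInvariant.lean`):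

* `ModularForms.E₆_rho_eq_ofReal`, `ModularForms.E₆_rho_re_pos_and_im`: **`E₆(ρ)` is real and
  `> 1`** — from Mathlib's `q`-expansion `EisensteinSeries.q_expansion_bernoulli` at the nome
  `q = −x`, `x = e^{−π√3} < 1/136` (`π√3 > 5`, `e⁵ > 136`): `E₆(ρ) = 1 + 504x − 504∑_{n≥2} σ₅(n)qⁿ`
  with `|∑_{n≥2} σ₅(n)qⁿ| ≤ ∑_{n≥2} 2(8x)ⁿ = 128x²/(1 − 8x) < x` (`σ₅(n) ≤ n⁶ ≤ 2·8ⁿ`);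
* `EisensteinLattice.isReal`, `….minRealPeriod_eq`: `Λ_ρ` is a real lattice (stable under
  conjugation, `conj ρ = −1 − ρ`) with least positive real period `1`;
* `EisensteinLattice.weierstrassPRe_half_eq_of_isReal`, `….g₃_eq_of_isReal`: for ANY real lattice
  with least real period `1`, `g₂ = 0` and `g₃ > 0`: `e₁ = ℘(1/2)` is the real root of `4x³ = g₃`
  (`℘'(1/2) = 0`), `e₁ > 0`, and the period formula
  `∫_{e₁}^∞ dx/√(4x³ − 4e₁³) = Ω₀/2 = 1/2` (`PeriodPair.IsReal.integral_Ioi_inv_sqrt_cubic_eq`,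
  Lawden (6.12.4)) with the scaling `x = e₁u` gives `√e₁ = ∫₁^∞ du/√(u³ − 1) = ω₁`, the
  equianharmonic constant `ω₁ = 2^{2/3}Γ(1/3)³/(4π) = Γ(1/3)³/(2^{4/3}π)`
  (`Literature.Analysis.SpecialFunctions.integral_Ioi_one_inv_sqrt_cube_sub_one`); hence
  `℘(1/2) = ω₁²` and `g₃ = 4ω₁⁶ = Γ(1/3)¹⁸/(64π⁶)` (`(2^{2/3})⁶ = 16`);
* `EisensteinLattice.g₃_re_pos` (`g₃(Λ_ρ) = (8π⁶/27)E₆(ρ) > 0`), `….weierstrassPRe_half_eq`,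
  `….g₃_eq_Gamma`: **`g₃(ℤρ + ℤ) = Γ(1/3)¹⁸/(64π⁶)`** — Waldschmidt's "The lattice `ℤ[ϱ]` has
  `g₃ = 4ω₁⁶`. Thus `∑ (m + nϱ)⁻⁶ = Γ(1/3)¹⁸/(2⁸·5·7·π⁶)`";
* `ModularForms.E₆_rho`: **`E₆(ρ) = 27g₃/(8π⁶) = 27Γ(1/3)¹⁸/(2⁹π¹²)`** — the value
  `R(−e^{−π√3}) = (27/2)(ω₁/π)⁶` of Ramanujan's `R` at the nome of `ρ`, the last input of
  Nesterenko's Corollary on `π, e^{π√3}, Γ(1/3)` (the tree's named fact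
  `Literature.NumberTheory.Transcendental.nesterenko'`; see
  `Literature/Barriers/Schanuel/NesterenkoModularScopeValuesRhoProofs.lean`).

All statements are proved; there are no new definitions.

## References

* M. Waldschmidt, *Elliptic functions and transcendence*, Surveys in Number Theory, Dev. Math. 17,
  Springer 2008, §2.3 formula (6) (lit PDF p. 135: `ω₁ = ∫₁^∞ dx/√(x³ − 1) = Γ(1/3)³/(2^{4/3}π)`,
  "The lattice `ℤ[ϱ]` has `g₃ = 4ω₁⁶`"), §5.4 formula (13) (PDF p. 151:
  `R(−e^{−π√3}) = (27/2)(ω₁/π)⁶`). [Waldschmidt2008EllipticSurvey]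
* Yu. V. Nesterenko, P. Philippon (eds.), LNM 1752 (2001), Ch. 1 §3 Remark (ii) (PDF p. 19).
  [NesterenkoPhilippon2001]
* D. F. Lawden, *Elliptic Functions and Applications* (1989), §6.11–6.12, eq. (6.12.4).
* J.-P. Serre, *A Course in Arithmetic*, VII §2.3, §4.
-/

noncomputable section

open UpperHalfPlane hiding I
open Complex EisensteinSeries ModularForm MeasureTheory Set Filter PeriodPair
open scoped Real Topology PeriodPair ArithmeticFunction.sigma MatrixGroups ComplexConjugate


namespace Literature.NumberTheory.EllipticCurves

/-! ### `E₆(ρ)` is real and positive (the `q`-expansion at the nome `−e^{−π√3}`) -/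

namespace ModularForms

/-- `n⁶ ≤ 2·8ⁿ` for every natural number `n`. [folklore] -/
theorem pow_six_le_two_mul_eight_pow (n : ℕ) : (n : ℝ) ^ 6 ≤ 2 * 8 ^ n := by
  rcases lt_or_ge n 3 with h | h
  · interval_cases n <;> norm_num
  · induction n, h using Nat.le_induction with
    | base => norm_num
    | succ k hk ih =>
      have hk' : (3 : ℝ) ≤ k := by exact_mod_cast hk
      have hk0 : (0 : ℝ) ≤ k := by positivity
      have step : ((k : ℝ) + 1) ^ 6 ≤ 8 * (k : ℝ) ^ 6 := by
        have h1 : (k : ℝ) + 1 ≤ 4 / 3 * k := by linarith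
        have h0 : (0 : ℝ) ≤ k + 1 := by positivity
        calc ((k : ℝ) + 1) ^ 6 ≤ (4 / 3 * k) ^ 6 := pow_le_pow_left₀ h0 h1 6
          _ = (4096 / 729) * (k : ℝ) ^ 6 := by ring
          _ ≤ 8 * (k : ℝ) ^ 6 := by nlinarith [pow_nonneg hk0 6]
      push_cast
      calc ((k : ℝ) + 1) ^ 6 ≤ 8 * (k : ℝ) ^ 6 := step
        _ ≤ 8 * (2 * 8 ^ k) := by linarith
        _ = 2 * 8 ^ (k + 1) := by ring

/-- `σ₅(n) ≤ 2·8ⁿ`. [folklore] -/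
theorem sigma_five_le (n : ℕ) : (σ 5 n : ℝ) ≤ 2 * 8 ^ n := by
  have h1 : (σ 5 n : ℝ) ≤ (n : ℝ) ^ 6 := by
    exact_mod_cast ArithmeticFunction.sigma_le_pow_succ 5 n
  exact h1.trans (pow_six_le_two_mul_eight_pow n)

/-- The nome modulus at `ρ`: `x = e^{−π√3} < 1/136` (`π√3 > 5`, `e⁵ > 136`). [folklore] -/
theorem exp_neg_pi_sqrt_three_lt : Real.exp (-(π * Real.sqrt 3)) < 1 / 136 := by
  have h3 : (5 / 3 : ℝ) < Real.sqrt 3 := by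
    rw [Real.lt_sqrt (by norm_num)]; norm_num
  have h5 : (5 : ℝ) < π * Real.sqrt 3 := by
    have := Real.pi_gt_three
    nlinarith
  have he : (136 : ℝ) < Real.exp 5 := by
    have h1 : (2.7182818283 : ℝ) < Real.exp 1 := Real.exp_one_gt_d9
    have : Real.exp 5 = Real.exp 1 ^ 5 := by
      rw [← Real.exp_nat_mul]; norm_num
    rw [this]
    have h0 : (0 : ℝ) ≤ 2.7182818283 := by norm_num
    have := pow_lt_pow_left₀ h1 h0 (by norm_num : (5 : ℕ) ≠ 0)
    refine lt_trans ?_ this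
    norm_num
  have h136 : (136 : ℝ) < Real.exp (π * Real.sqrt 3) :=
    he.trans (Real.exp_lt_exp.mpr h5)
  rw [Real.exp_neg, ← one_div]
  exact one_div_lt_one_div_of_lt (by norm_num) h136


/-- **`E₆(ρ)` is real and `> 1`**: with the nome `q = −x`, `x = e^{−π√3} < 1/136`, the
`q`-expansion `E₆(ρ) = 1 − 504 ∑_{n ≥ 1} σ₅(n) qⁿ = 1 + 504x − 504 ∑_{n ≥ 2} σ₅(n) qⁿ` has
`|∑_{n ≥ 2} σ₅(n) qⁿ| ≤ ∑_{n ≥ 2} 2(8x)ⁿ = 128x²/(1 − 8x) < x`. [folklore] -/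
theorem E₆_rho_eq_ofReal :
    ∃ r : ℝ, 1 < r ∧ (E₆ UpperHalfPlane.ρ : ℂ) = (r : ℂ) := by
  have h := EisensteinSeries.q_expansion_bernoulli (by norm_num : 3 ≤ 6) (by decide)
    UpperHalfPlane.ρ
  have hb : bernoulli 6 = 1 / 42 := by
    rw [bernoulli_eq_bernoulli'_of_ne_one (by norm_num), PeriodPair.bernoulli'_six]
  simp_rw [zpow_natCast] at h
  rw [cexp_two_pi_I_rho, hb] at h
  set x : ℝ := Real.exp (-(π * Real.sqrt 3)) with hxdef
  have hx0 : 0 < x := Real.exp_pos _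
  have hx : x < 1 / 136 := exp_neg_pi_sqrt_three_lt
  have h8x : 8 * x < 1 := by linarith
  have h8x0 : 0 ≤ 8 * x := by linarith
  set S : ℝ := ∑' n : ℕ+, (σ 5 n : ℝ) * (-x) ^ (n : ℕ) with hSdef
  refine ⟨1 - 504 * S, ?_, ?_⟩
  · suffices hS0 : S < 0 by linarith
    -- reindex over `ℕ`
    set g : ℕ → ℝ := fun m => (σ 5 (m + 1) : ℝ) * (-x) ^ (m + 1) with hgdef
    have hS : S = ∑' m : ℕ, g m :=
      tsum_pnat_eq_tsum_succ (f := fun n : ℕ => (σ 5 n : ℝ) * (-x) ^ n)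
    have hbound : ∀ m, ‖g m‖ ≤ 2 * (8 * x) ^ (m + 1) := by
      intro m
      rw [hgdef, Real.norm_eq_abs, abs_mul, abs_pow, abs_neg, abs_of_pos hx0, Nat.abs_cast]
      calc (σ 5 (m + 1) : ℝ) * x ^ (m + 1) ≤ 2 * 8 ^ (m + 1) * x ^ (m + 1) := by
            gcongr; exact sigma_five_le _
        _ = 2 * (8 * x) ^ (m + 1) := by rw [mul_pow]; ring
    have hgeom : Summable (fun m : ℕ => 2 * (8 * x) ^ (m + 1)) := by
      have := (summable_geometric_of_lt_one h8x0 h8x).mul_left (2 * (8 * x))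
      refine this.congr (fun m => ?_)
      ring
    have hsum : Summable g := Summable.of_norm_bounded hgeom hbound
    have hsplit := hsum.tsum_eq_zero_add
    have hg0 : g 0 = -x := by
      simp [hgdef, ArithmeticFunction.sigma_apply, Nat.divisors_one]
    have htail_sum : Summable (fun m => g (m + 1)) := (summable_nat_add_iff 1).mpr hsum
    have hgeom2 : Summable (fun m : ℕ => 2 * (8 * x) ^ (m + 2)) := by
      have := (summable_geometric_of_lt_one h8x0 h8x).mul_left (2 * (8 * x) ^ 2)
      refine this.congr (fun m => ?_)
      ring
    have htail_le : ∑' m, g (m + 1) ≤ ∑' m : ℕ, 2 * (8 * x) ^ (m + 2) := by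
      refine Summable.tsum_le_tsum (fun m => ?_) htail_sum hgeom2
      exact (le_abs_self _).trans (by simpa [Real.norm_eq_abs] using hbound (m + 1))
    have hgeom_val : ∑' m : ℕ, 2 * (8 * x) ^ (m + 2) = 2 * (8 * x) ^ 2 / (1 - 8 * x) := by
      rw [show (fun m : ℕ => 2 * (8 * x) ^ (m + 2)) = fun m => (2 * (8 * x) ^ 2) * (8 * x) ^ m by
        funext m; ring]
      rw [tsum_mul_left, tsum_geometric_of_lt_one h8x0 h8x]
      field_simp
    have hSx : S = -x + ∑' m, g (m + 1) := by rw [hS, hsplit, hg0]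
    rw [hSx]
    have h1 : 2 * (8 * x) ^ 2 / (1 - 8 * x) < x := by
      rw [div_lt_iff₀ (by linarith)]
      nlinarith
    linarith
  · rw [show (E₆ UpperHalfPlane.ρ : ℂ) = E (by norm_num : 3 ≤ 6) UpperHalfPlane.ρ from rfl, h,
      hSdef, Complex.ofReal_sub, Complex.ofReal_mul, Complex.ofReal_tsum]
    push_cast
    ring

/-- **`E₆(ρ)` is a positive real number** (`> 1`). [folklore] -/
theorem E₆_rho_re_pos_and_im : 0 < (E₆ UpperHalfPlane.ρ : ℂ).re ∧ (E₆ UpperHalfPlane.ρ : ℂ).im = 0 := by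
  obtain ⟨r, hr, hE⟩ := E₆_rho_eq_ofReal
  rw [hE, Complex.ofReal_re, Complex.ofReal_im]
  exact ⟨by linarith, rfl⟩

end ModularForms


/-! ### The Eisenstein lattice `ℤρ + ℤ` -/

namespace EisensteinLattice

/-- Membership in `ℤρ + ℤ`. [folklore] -/
theorem mem_lattice_iff {x : ℂ} :
    x ∈ (ofUpperHalfPlane UpperHalfPlane.ρ).lattice ↔
      ∃ m n : ℤ, (m : ℂ) * UpperHalfPlane.ρ + n = x := by
  rw [PeriodPair.mem_lattice]
  simp

/-- `conj ρ = −1 − ρ`. [folklore] -/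
theorem conj_rho : conj ((UpperHalfPlane.ρ : ℍ) : ℂ) = -1 - (UpperHalfPlane.ρ : ℂ) := by
  have hρ : ((UpperHalfPlane.ρ : ℍ) : ℂ) = ⟨-1 / 2, Real.sqrt 3 / 2⟩ := rfl
  rw [hρ]
  apply Complex.ext
  · simp; norm_num
  · simp

/-- `ℤρ + ℤ` is a real lattice (stable under complex conjugation: `conj(mρ + n) = −mρ + (n − m)`).
[folklore] -/
theorem isReal : (ofUpperHalfPlane UpperHalfPlane.ρ).IsReal := by
  intro z hz
  rw [mem_lattice_iff] at hz ⊢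
  obtain ⟨m, n, rfl⟩ := hz
  refine ⟨-m, n - m, ?_⟩
  simp only [map_add, map_mul, map_intCast, conj_rho]
  push_cast
  ring

/-- A real number lies in `ℤρ + ℤ` iff it is an integer. [folklore] -/
theorem ofReal_mem_lattice_iff {t : ℝ} :
    (t : ℂ) ∈ (ofUpperHalfPlane UpperHalfPlane.ρ).lattice ↔ ∃ n : ℤ, (n : ℝ) = t := by
  rw [mem_lattice_iff]
  have hρ : ((UpperHalfPlane.ρ : ℍ) : ℂ) = ⟨-1 / 2, Real.sqrt 3 / 2⟩ := rfl
  constructor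
  · rintro ⟨m, n, h⟩
    have him := congrArg Complex.im h
    have hre := congrArg Complex.re h
    rw [hρ] at him hre
    simp only [Complex.add_im, Complex.mul_im, Complex.intCast_re, Complex.intCast_im,
      zero_mul, add_zero, Complex.ofReal_im] at him
    have hs : Real.sqrt 3 ≠ 0 := by positivity
    have hm : (m : ℝ) = 0 := by
      have : (m : ℝ) * (Real.sqrt 3 / 2) = 0 := him
      rcases mul_eq_zero.mp this with h0 | h0
      · exact h0
      · exfalso; apply hs; linarith
    simp only [Complex.add_re, Complex.mul_re, Complex.intCast_re, Complex.intCast_im,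
      zero_mul, sub_zero, Complex.ofReal_re, hm] at hre
    exact ⟨n, by linarith⟩
  · rintro ⟨n, rfl⟩
    exact ⟨0, n, by simp⟩

/-- The least positive real period of `ℤρ + ℤ` is `1`. [folklore] -/
theorem minRealPeriod_eq : (ofUpperHalfPlane UpperHalfPlane.ρ).minRealPeriod = 1 := by
  have h1 : (1 : ℝ) ∈ (ofUpperHalfPlane UpperHalfPlane.ρ).realPeriods :=
    ⟨one_pos, by exact_mod_cast (ofUpperHalfPlane UpperHalfPlane.ρ).ω₂_mem_lattice⟩
  have hleast : IsLeast (ofUpperHalfPlane UpperHalfPlane.ρ).realPeriods 1 := by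
    refine ⟨h1, fun t ht => ?_⟩
    obtain ⟨ht0, htmem⟩ := ht
    obtain ⟨n, rfl⟩ := ofReal_mem_lattice_iff.mp htmem
    have : (0 : ℤ) < n := by exact_mod_cast ht0
    exact_mod_cast this
  exact hleast.csInf_eq

end EisensteinLattice

/-! ### Real lattices with `Ω₀ = 1` and `g₂ = 0`: `℘(1/2) = ω₁²`, `g₃ = 4ω₁⁶` -/

namespace EisensteinLattice

variable {L : PeriodPair}

/-- For a real lattice with `Ω₀ = 1` and `g₂ = 0`, `e₁ = ℘(1/2)` satisfies `4e₁³ = g₃`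
(`℘'(1/2) = 0` in `℘'² = 4℘³ − g₂℘ − g₃`). [folklore] -/
theorem cubic_weierstrassPRe_half (h : L.IsReal) (h1 : L.minRealPeriod = 1) (h2 : L.g₂ = 0) :
    4 * L.weierstrassPRe (1 / 2) ^ 3 - L.g₃.re = 0 := by
  have hsq := h.derivWeierstrassPRe_sq (GaussianLattice.one_half_notMem h h1)
  have hder : L.derivWeierstrassPRe (1 / 2) = 0 := by
    have := h.derivWeierstrassP_minRealPeriod_div_two
    rw [h1] at this
    rw [PeriodPair.derivWeierstrassPRe_def, this, Complex.zero_re]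
  rw [hder, h2] at hsq
  simp only [ne_eq, OfNat.ofNat_ne_zero, not_false_eq_true, zero_pow, Complex.zero_re,
    zero_mul, sub_zero] at hsq
  linarith

/-- Scaling `x = eu` in the equianharmonic period integral: for `e > 0`,
`∫_e^∞ dx/√(4x³ − 4e³) = (∫₁^∞ du/√(u³ − 1))/(2√e)`. [folklore] -/
theorem integral_Ioi_inv_sqrt_cubic_scaling {e : ℝ} (he : 0 < e) :
    ∫ x in Ioi e, (Real.sqrt (4 * x ^ 3 - 4 * e ^ 3))⁻¹ =
      (∫ u in Ioi (1 : ℝ), (Real.sqrt (u ^ 3 - 1))⁻¹) / (2 * Real.sqrt e) := by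
  set F : ℝ → ℝ := fun x => (Real.sqrt (4 * x ^ 3 - 4 * e ^ 3))⁻¹ with hF
  have hsub := MeasureTheory.integral_comp_mul_left_Ioi F 1 he
  rw [mul_one] at hsub
  have hmain : ∫ x in Ioi e, F x = e * ∫ u in Ioi (1 : ℝ), F (e * u) := by
    rw [hsub, smul_eq_mul, ← mul_assoc, mul_inv_cancel₀ he.ne', one_mul]
  have hpt : EqOn (fun u => F (e * u))
      (fun u => (2 * e * Real.sqrt e)⁻¹ * (Real.sqrt (u ^ 3 - 1))⁻¹) (Ioi (1 : ℝ)) := by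
    intro u hu
    simp only [hF]
    have hu1 : (1 : ℝ) < u := hu
    have hfac : 4 * (e * u) ^ 3 - 4 * e ^ 3 =
        (2 * e * Real.sqrt e) ^ 2 * (u ^ 3 - 1) := by
      rw [show (2 * e * Real.sqrt e) ^ 2 = 4 * e ^ 2 * Real.sqrt e ^ 2 by ring,
        Real.sq_sqrt he.le]
      ring
    have hu3 : 0 ≤ u ^ 3 - 1 := by
      have := one_lt_pow₀ hu1 (n := 3) (by norm_num)
      linarith
    rw [hfac, Real.sqrt_mul' _ hu3, Real.sqrt_sq (by positivity), mul_inv]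
  rw [hmain, setIntegral_congr_fun measurableSet_Ioi hpt, integral_const_mul]
  have hs : Real.sqrt e ≠ 0 := (Real.sqrt_pos.mpr he).ne'
  field_simp

/-- For a real lattice with `Ω₀ = 1`, `g₂ = 0` and `g₃ > 0`: **`℘(1/2) = ω₁²`**, where
`ω₁ = ∫₁^∞ du/√(u³ − 1) = 2^{2/3}Γ(1/3)³/(4π)` (the period formula
`∫_{e₁}^∞ dx/√(4x³ − 4e₁³) = Ω₀/2 = 1/2` and the scaling `x = e₁u` give `√e₁ = ω₁`). [folklore] -/
theorem weierstrassPRe_half_eq_of_isReal (h : L.IsReal) (h1 : L.minRealPeriod = 1)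
    (h2 : L.g₂ = 0) (hg : 0 < L.g₃.re) :
    L.weierstrassPRe (1 / 2) = ((2 : ℝ) ^ (2 / 3 : ℝ) * Real.Gamma (1 / 3) ^ 3 / (4 * π)) ^ 2 := by
  have hroot := cubic_weierstrassPRe_half h h1 h2
  have he : 0 < L.weierstrassPRe (1 / 2) := by
    rcases le_or_gt (L.weierstrassPRe (1 / 2)) 0 with hle | hpos
    · have : L.weierstrassPRe (1 / 2) ^ 3 ≤ 0 := Odd.pow_nonpos (by decide) hle
      linarith
    · exact hpos
  have hint := h.integral_Ioi_inv_sqrt_cubic_eq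
  have hg3 : L.g₃.re = 4 * L.weierstrassPRe (1 / 2) ^ 3 := by linarith
  rw [h1, h2, Complex.zero_re, hg3] at hint
  simp only [zero_mul, sub_zero] at hint
  rw [integral_Ioi_inv_sqrt_cubic_scaling he,
    Literature.Analysis.SpecialFunctions.integral_Ioi_one_inv_sqrt_cube_sub_one] at hint
  set ω : ℝ := (2 : ℝ) ^ (2 / 3 : ℝ) * Real.Gamma (1 / 3) ^ 3 / (4 * π) with hω
  have hs : 0 < Real.sqrt (L.weierstrassPRe (1 / 2)) := Real.sqrt_pos.mpr he
  have hsqrt : Real.sqrt (L.weierstrassPRe (1 / 2)) = ω := by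
    field_simp at hint
    linarith
  have hsq := Real.sq_sqrt he.le
  rw [hsqrt] at hsq
  exact hsq.symm

/-- … and **`g₃ = 4ω₁⁶ = Γ(1/3)¹⁸/(64π⁶)`** (`(2^{2/3})⁶ = 16`). [folklore] -/
theorem g₃_eq_of_isReal (h : L.IsReal) (h1 : L.minRealPeriod = 1) (h2 : L.g₂ = 0)
    (hg : 0 < L.g₃.re) : L.g₃ = (Real.Gamma (1 / 3) : ℂ) ^ 18 / (64 * (π : ℂ) ^ 6) := by
  have hroot := cubic_weierstrassPRe_half h h1 h2
  rw [weierstrassPRe_half_eq_of_isReal h h1 h2 hg] at hroot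
  have h16 : ((2 : ℝ) ^ (2 / 3 : ℝ)) ^ 6 = 16 := by
    rw [← Real.rpow_natCast, ← Real.rpow_mul (by norm_num : (0 : ℝ) ≤ 2)]
    rw [show (2 / 3 : ℝ) * ((6 : ℕ) : ℝ) = ((4 : ℕ) : ℝ) by norm_num, Real.rpow_natCast]
    norm_num
  have hg3 : L.g₃.re = Real.Gamma (1 / 3) ^ 18 / (64 * π ^ 6) := by
    have hπ : π ≠ 0 := Real.pi_ne_zero
    have e : L.g₃.re = 4 * (((2 : ℝ) ^ (2 / 3 : ℝ) * Real.Gamma (1 / 3) ^ 3 / (4 * π)) ^ 2) ^ 3 := by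
      linarith
    rw [e]
    rw [show (((2 : ℝ) ^ (2 / 3 : ℝ) * Real.Gamma (1 / 3) ^ 3 / (4 * π)) ^ 2) ^ 3 =
      ((2 : ℝ) ^ (2 / 3 : ℝ)) ^ 6 * Real.Gamma (1 / 3) ^ 18 / (4 * π) ^ 6 by ring, h16]
    field_simp
    ring
  rw [← h.ofReal_g₃_re, hg3]
  push_cast
  ring

/-- `g₃(ℤρ + ℤ) = (8π⁶/27)E₆(ρ)` is a positive real number. [folklore] -/
theorem g₃_re_pos : 0 < (ofUpperHalfPlane UpperHalfPlane.ρ).g₃.re := by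
  obtain ⟨r, hr, hE⟩ := ModularForms.E₆_rho_eq_ofReal
  rw [PeriodPair.g₃_ofUpperHalfPlane, hE]
  have : (8 * (π : ℂ) ^ 6 / 27) * (r : ℂ) = ((8 * π ^ 6 / 27 * r : ℝ) : ℂ) := by push_cast; ring
  rw [this, Complex.ofReal_re]
  have hr0 : 0 < r := by linarith
  positivity

/-- **`℘_{ℤρ+ℤ}(1/2) = ω₁²`**, `ω₁ = 2^{2/3}Γ(1/3)³/(4π) = Γ(1/3)³/(2^{4/3}π)` (the real root `e₁`
of `4x³ − g₃`). [folklore] -/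
theorem weierstrassPRe_half_eq :
    (ofUpperHalfPlane UpperHalfPlane.ρ).weierstrassPRe (1 / 2) =
      ((2 : ℝ) ^ (2 / 3 : ℝ) * Real.Gamma (1 / 3) ^ 3 / (4 * π)) ^ 2 :=
  weierstrassPRe_half_eq_of_isReal isReal minRealPeriod_eq PeriodPair.g₂_ofUpperHalfPlane_ρ
    g₃_re_pos

/-- **`g₃(ℤρ + ℤ) = Γ(1/3)¹⁸/(64π⁶)`** ("The lattice `ℤ[ϱ]` has `g₃ = 4ω₁⁶`", Waldschmidt 2008
§2.3 (6)), i.e. `∑' (mρ + n)⁻⁶ = g₃/140 = Γ(1/3)¹⁸/(2⁸·5·7·π⁶)`.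
[cite: Waldschmidt2008EllipticSurvey, §2.3 formula (6) (PDF p. 135)] -/
theorem g₃_eq_Gamma :
    (ofUpperHalfPlane UpperHalfPlane.ρ).g₃ = (Real.Gamma (1 / 3) : ℂ) ^ 18 / (64 * (π : ℂ) ^ 6) :=
  g₃_eq_of_isReal isReal minRealPeriod_eq PeriodPair.g₂_ofUpperHalfPlane_ρ g₃_re_pos

end EisensteinLattice

/-! ### `E₆(ρ) = 27Γ(1/3)¹⁸/(2⁹π¹²)` -/

namespace ModularForms

/-- **`E₆(ρ) = 27Γ(1/3)¹⁸/(2⁹π¹²)`** (`= 27g₃(ℤρ+ℤ)/(8π⁶)`; the Chowla–Selberg value for `ℚ(√−3)`;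
Waldschmidt 2008 §5.4 (13): `R(−e^{−π√3}) = (27/2)(ω₁/π)⁶`, `ω₁ = Γ(1/3)³/(2^{4/3}π)`).
[cite: Waldschmidt2008EllipticSurvey, §5.4 formula (13) (PDF p. 151)] -/
theorem E₆_rho : (E₆ UpperHalfPlane.ρ : ℂ) =
    27 * (Real.Gamma (1 / 3) : ℂ) ^ 18 / (2 ^ 9 * (π : ℂ) ^ 12) := by
  have h := PeriodPair.g₃_ofUpperHalfPlane UpperHalfPlane.ρ
  have hπ : (π : ℂ) ≠ 0 := Complex.ofReal_ne_zero.mpr Real.pi_ne_zero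
  have hE : (E₆ UpperHalfPlane.ρ : ℂ) =
      27 / (8 * (π : ℂ) ^ 6) * (ofUpperHalfPlane UpperHalfPlane.ρ).g₃ := by
    rw [h]; field_simp
  rw [hE, EisensteinLattice.g₃_eq_Gamma]
  field_simp
  ring

end ModularForms

end Literature.NumberTheory.EllipticCurves

end
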